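import Mathlib
import HarnessLib
import Literature.MathematicalPhysics.QuantumFieldTheory.CircleHaarAngle
import Summits.Ventures.LatticeQCDFlow.Exactness.CircleDegreeOneJacobian
import Summits.Ventures.LatticeQCDFlow.Exactness.SphereKickJacobianTransport

/-!
# U(1) as the tree's `Circle` with `haarProbability`: degree-one lifts and their coupling layers have exact Jacobian for the reference measure of `wilson_flow_reweighting_exact`

HONEST FRAMING: exact (Metropolis-corrected) sampling algorithms for lattice gauge theory;
figures of merit are autocorrelation/cost numbers at stated couplings and volumes; no
continuum-physics claim.

Venture `LatticeQCDFlow` (cell pub-lqcd), topic `Exactness`; FANOUT row 14 (`eng-flowhmc`).  NEW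
WORK of the cell; nothing is cited as a fact.  It transports row 14's certificates from the
additive circle `AddCircle (2π)` with `volume` (files `CircleDegreeOneJacobian`,
`U1MaskedLayer*`, `NCPCircleJacobian`) to the vocabulary of the tree's gauge-theory files: the
multiplicative group `U(1) = Circle` with the normalised Haar measure `haarProbability Circle`
(`ConstructiveQFTWave0.haarProbability`, Borel structure from `GrassmannIntegral`), i.e. the link
space and reference measure of `GaugeConfig d L Circle` in
`FlowPushforward.wilson_flow_reweighting_exact` and of row 31's `Theory2.hasJacobian_coupleFun`
with `m = haarProbability Circle`.  Tools: the Literature dictionary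
`CircleHaar.map_toCircle_volume` (`toCircle_* volume = 2π · haarProbability`), Mathlib's
homeomorphism `AddCircle.homeomorphCircle'` (`↑θ ↦ e^{iθ}`) as a measurable equivalence, row 31's
`Theory2.hasJacobian_conj` (transport along `≃ᵐ`), row 7's `HasJacobian.smul` (scaling).

## Content

* `coe_circleEquiv_apply_coe`, `coe_circleEquiv_eq_toCircle`, `map_circleEquiv_volume` — the
  measurable equivalence `ℝ/2πℤ ≃ᵐ U(1)` is `↑θ ↦ e^{iθ}` and pushes `volume` to
  `2π · haarProbability Circle`;
* `Circle.measurable_of_measurable_comp_exp(_prod)` — measurability on `U(1)` (× parameters)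
  through `θ ↦ e^{iθ}`;
* **`hasJacobian_circleGroup_of_degreeOne`** — for a `C¹` degree-one lift `Φ` with positive
  continuous derivative, any `F : U(1) → U(1)` with `F(e^{iθ}) = e^{iΦ(θ)}` and any `J` with
  `J(e^{iθ}) = Φ'(θ)` satisfy `HasJacobian (haarProbability Circle) F J`;
* **`hasJacobian_coupleFun_circleGroup_of_degreeOne`** — on `ι → U(1)` with
  `Measure.pi fun _ => haarProbability Circle` (the product Haar reference of the cell's Wilson /
  flow theorems), a coupling layer whose active links are moved by such lifts, jointly measurable
  in the frozen links, has `HasJacobian _ (coupleFun p ψ) (ofReal ∘ coupleJac p jac)`.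
  Instances: the FT-HMC engine's sin-sum layers (`hasDerivAt_u1Layer`, `u1LayerJac_pos`,
  `u1Layer_add_int_mul_two_pi`) and the NCP mixtures (`NCPCircleJacobian.lean`).

NOT here: SU(N); autocorrelations; any number.
-/

noncomputable section

namespace Summit.Ventures.LatticeQCDFlow.Exactness

open Real Set Function MeasureTheory Summit.Ventures.LatticeQCDFlow.Theory2
open Literature.MathematicalPhysics.QuantumFieldTheory (haarProbability)
open Literature.MathematicalPhysics.QuantumFieldTheory.CircleHaar
open scoped NNReal ENNReal

/-! ## The equivalence `ℝ/2πℤ ≃ᵐ U(1)` and the two Haar measures -/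

/-- On representatives the equivalence is `θ ↦ e^{iθ}`. -/
theorem coe_circleEquiv_apply_coe (θ : ℝ) :
    (Homeomorph.toMeasurableEquiv AddCircle.homeomorphCircle' : AddCircle (2 * π) ≃ᵐ Circle)
      (θ : AddCircle (2 * π)) = Circle.exp θ := by
  rw [Homeomorph.toMeasurableEquiv_coe, AddCircle.homeomorphCircle'_apply_mk]

/-- The equivalence is the group isomorphism `AddCircle.toCircle`. -/
theorem coe_circleEquiv_eq_toCircle :
    ⇑(Homeomorph.toMeasurableEquiv AddCircle.homeomorphCircle' : AddCircle (2 * π) ≃ᵐ Circle) =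
      AddCircle.toCircle (T := 2 * π) := by
  funext x
  induction x using QuotientAddGroup.induction_on with
  | H θ => rw [coe_circleEquiv_apply_coe, toCircle_coe]

/-- It pushes the Haar measure `volume` of `ℝ/2πℤ` (mass `2π`) to `2π · haarProbability Circle`. -/
theorem map_circleEquiv_volume :
    Measure.map
        (⇑(Homeomorph.toMeasurableEquiv AddCircle.homeomorphCircle' : AddCircle (2 * π) ≃ᵐ Circle))
        (volume : Measure (AddCircle (2 * π))) =
      ENNReal.ofReal (2 * π) • haarProbability Circle := by
  rw [coe_circleEquiv_eq_toCircle]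
  exact map_toCircle_volume

/-- … equivalently its inverse pulls `2π · haarProbability Circle` back to `volume`. -/
theorem map_circleEquiv_symm_smul_haar :
    Measure.map
        (⇑(Homeomorph.toMeasurableEquiv AddCircle.homeomorphCircle' :
          AddCircle (2 * π) ≃ᵐ Circle).symm)
        (ENNReal.ofReal (2 * π) • haarProbability Circle) =
      (volume : Measure (AddCircle (2 * π))) := by
  rw [← map_circleEquiv_volume, MeasurableEquiv.map_symm_map]

/-! ## Measurability on `U(1)` through `θ ↦ e^{iθ}` -/

/-- A function on `U(1)` is measurable as soon as `θ ↦ g(e^{iθ})` is. -/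
theorem Circle.measurable_of_measurable_comp_exp {B : Type*} [MeasurableSpace B] {g : Circle → B}
    (hg : Measurable fun θ : ℝ => g (Circle.exp θ)) : Measurable g := by
  have h1 : Measurable fun x : AddCircle (2 * π) =>
      g ((Homeomorph.toMeasurableEquiv AddCircle.homeomorphCircle' :
      AddCircle (2 * π) ≃ᵐ Circle) x) :=
    AddCircle.measurable_of_measurable_comp_coe (by simp_rw [coe_circleEquiv_apply_coe]; exact hg)
  have h2 := h1.comp
    (Homeomorph.toMeasurableEquiv AddCircle.homeomorphCircle' : AddCircle (2 * π) ≃ᵐ Circle).symm.measurable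
  convert h2 using 1
  funext z
  simp only [Function.comp_apply, MeasurableEquiv.apply_symm_apply]

/-- The same with a parameter. -/
theorem Circle.measurable_of_measurable_comp_exp_prod {B P : Type*} [MeasurableSpace B]
    [MeasurableSpace P] {g : Circle × P → B}
    (hg : Measurable fun w : ℝ × P => g (Circle.exp w.1, w.2)) : Measurable g := by
  have h1 : Measurable fun z : AddCircle (2 * π) × P =>
      g ((Homeomorph.toMeasurableEquiv AddCircle.homeomorphCircle' :
      AddCircle (2 * π) ≃ᵐ Circle) z.1, z.2) :=
    AddCircle.measurable_of_measurable_comp_coe_prod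
      (by simp_rw [coe_circleEquiv_apply_coe]; exact hg)
  have h2 := h1.comp
    (((Homeomorph.toMeasurableEquiv AddCircle.homeomorphCircle' :
      AddCircle (2 * π) ≃ᵐ Circle).symm.measurable.comp
      measurable_fst).prodMk measurable_snd)
  convert h2 using 1
  funext z
  simp only [Function.comp_apply, MeasurableEquiv.apply_symm_apply]

/-! ## One link: `HasJacobian (haarProbability Circle)` -/

section OneLink

variable {Φ Φ' : ℝ → ℝ}

/-- **Degree-one lifts are certified `U(1)` link maps for the normalised Haar measure.** -/
theorem hasJacobian_circleGroup_of_degreeOne (hderiv : ∀ θ, HasDerivAt Φ (Φ' θ) θ)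
    (hcont : Continuous Φ') (hpos : ∀ θ, 0 < Φ' θ) (hdeg : ∀ θ, Φ (θ + 2 * π) = Φ θ + 2 * π)
    {F : Circle → Circle} (hF : ∀ θ : ℝ, F (Circle.exp θ) = Circle.exp (Φ θ))
    {J : Circle → ℝ≥0∞} (hJ : ∀ θ : ℝ, J (Circle.exp θ) = ENNReal.ofReal (Φ' θ)) :
    HasJacobian (haarProbability Circle) F J := by
  -- the conjugate map on `ℝ/2πℤ` is certified by `hasJacobian_circle_of_degreeOne`
  have hA : HasJacobian (volume : Measure (AddCircle (2 * π)))
      (fun x => (Homeomorph.toMeasurableEquiv AddCircle.homeomorphCircle' :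
      AddCircle (2 * π) ≃ᵐ Circle).symm
        (F ((Homeomorph.toMeasurableEquiv AddCircle.homeomorphCircle' :
      AddCircle (2 * π) ≃ᵐ Circle) x)))
      (fun x => J ((Homeomorph.toMeasurableEquiv AddCircle.homeomorphCircle' :
      AddCircle (2 * π) ≃ᵐ Circle) x)) := by
    refine hasJacobian_circle_of_degreeOne hderiv hcont hpos hdeg (fun θ => ?_) (fun θ => ?_)
    · rw [coe_circleEquiv_apply_coe, hF, ← coe_circleEquiv_apply_coe (Φ θ),
        MeasurableEquiv.symm_apply_apply]
    · rw [coe_circleEquiv_apply_coe, hJ]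
  -- transport to `U(1)` with `2π · haarProbability`, then rescale
  have hC := hasJacobian_conj
    (Homeomorph.toMeasurableEquiv AddCircle.homeomorphCircle' : AddCircle (2 * π) ≃ᵐ Circle).symm
    map_circleEquiv_symm_smul_haar hA
  have hC' : HasJacobian (ENNReal.ofReal (2 * π) • haarProbability Circle) F J := by
    convert hC using 1
    · funext z
      simp only [Function.comp_apply, MeasurableEquiv.symm_symm, MeasurableEquiv.apply_symm_apply]
    · funext z
      simp only [Function.comp_apply, MeasurableEquiv.apply_symm_apply]
  have hs := hC'.smul (ENNReal.ofReal (2 * π))⁻¹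
  rwa [smul_smul, ENNReal.inv_mul_cancel ofReal_two_pi_ne_zero ENNReal.ofReal_ne_top,
    one_smul] at hs

end OneLink

/-! ## Coupling layers on `ι → U(1)` with the product of normalised Haar measures -/

section Coupling

variable {ι : Type*} [Fintype ι] {p : ι → Prop} [DecidablePred p]

/-- **Coupling layers of degree-one lifts are exact on `ι → U(1)` for the product Haar probability
measure** — the reference measure of the cell's Wilson / flow-reweighting theorems with
`G = Circle`.  Active link `a`, frozen links `y : {i // ¬ p i} → U(1)`; lifts `Φ a y` with
derivative `Φ' a y` (`C¹`, positive, degree one, jointly measurable in `(θ, y)`); `ψ`, `jac` given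
by `ψ a y (e^{iθ}) = e^{iΦ a y θ}`, `jac a y (e^{iθ}) = Φ' a y θ`. -/
theorem hasJacobian_coupleFun_circleGroup_of_degreeOne
    {Φ Φ' : {i // p i} → ({i // ¬p i} → Circle) → ℝ → ℝ}
    (hderiv : ∀ a y θ, HasDerivAt (Φ a y) (Φ' a y θ) θ) (hcont : ∀ a y, Continuous (Φ' a y))
    (hpos : ∀ a y θ, 0 < Φ' a y θ) (hdeg : ∀ a y θ, Φ a y (θ + 2 * π) = Φ a y θ + 2 * π)
    (hΦm : ∀ a, Measurable fun w : ℝ × ({i // ¬p i} → Circle) => Φ a w.2 w.1)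
    (hΦ'm : ∀ a, Measurable fun w : ℝ × ({i // ¬p i} → Circle) => Φ' a w.2 w.1)
    {ψ : {i // p i} → ({i // ¬p i} → Circle) → Circle → Circle}
    (hψ : ∀ a y (θ : ℝ), ψ a y (Circle.exp θ) = Circle.exp (Φ a y θ))
    {jac : {i // p i} → ({i // ¬p i} → Circle) → Circle → ℝ}
    (hjac : ∀ a y (θ : ℝ), jac a y (Circle.exp θ) = Φ' a y θ) :
    HasJacobian (Measure.pi fun _ : ι => haarProbability Circle)
      (coupleFun p ψ) fun U => ENNReal.ofReal (coupleJac p jac U) := by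
  have hψm : ∀ a, Measurable fun q : Circle × ({i // ¬p i} → Circle) => ψ a q.2 q.1 := fun a => by
    refine Circle.measurable_of_measurable_comp_exp_prod ?_
    simp_rw [hψ]
    exact Circle.exp.continuous.measurable.comp (hΦm a)
  have hjm : ∀ a, Measurable fun q : Circle × ({i // ¬p i} → Circle) => jac a q.2 q.1 := fun a => by
    refine Circle.measurable_of_measurable_comp_exp_prod ?_
    simp_rw [hjac]
    exact hΦ'm a
  have hj0 : ∀ a y g, 0 ≤ jac a y g := fun a y g => by
    obtain ⟨θ, rfl⟩ := Circle.exp_surjective g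
    rw [hjac]
    exact (hpos a y θ).le
  refine hasJacobian_coupleFun (haarProbability Circle) hψm hjm (fun a y => ?_) hj0
  exact hasJacobian_circleGroup_of_degreeOne (hderiv a y) (hcont a y) (hpos a y) (hdeg a y)
    (hψ a y) fun θ => by simp only [hjac]

/-- **The FT-HMC engine's U(1) masked layer, in the tree's gauge-theory vocabulary.**  On
`ι → U(1)` with `Measure.pi fun _ => haarProbability Circle`: the masked layer whose active links
move by `e^{iθ} ↦ e^{i(θ + Σ_j c_j sin(α_j − θ))}` with coefficients / angles measurable in the
frozen links and `Σ_j |c_j| < 1`, Jacobian factor `1 − Σ_j c_j cos(α_j − θ)`, is a coupling layer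
with `HasJacobian _ (coupleFun p ψ) (ofReal ∘ coupleJac p jac)`. -/
theorem hasJacobian_coupleFun_circleGroup_u1Layer {n : ℕ}
    (c α : {i // p i} → ({i // ¬p i} → Circle) → Fin n → ℝ)
    (hc : ∀ a k, Measurable fun y => c a y k) (hα : ∀ a k, Measurable fun y => α a y k)
    (hκ : ∀ a y, ∑ k, |c a y k| < 1)
    {ψ : {i // p i} → ({i // ¬p i} → Circle) → Circle → Circle}
    (hψ : ∀ a y (θ : ℝ), ψ a y (Circle.exp θ) = Circle.exp (θ + ∑ k, c a y k * sin (α a y k - θ)))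
    {jac : {i // p i} → ({i // ¬p i} → Circle) → Circle → ℝ}
    (hjac : ∀ a y (θ : ℝ), jac a y (Circle.exp θ) = 1 - ∑ k, c a y k * cos (α a y k - θ)) :
    HasJacobian (Measure.pi fun _ : ι => haarProbability Circle)
      (coupleFun p ψ) fun U => ENNReal.ofReal (coupleJac p jac U) :=
  hasJacobian_coupleFun_circleGroup_of_degreeOne
    (Φ := fun a y θ => θ + ∑ k, c a y k * sin (α a y k - θ))
    (Φ' := fun a y θ => 1 - ∑ k, c a y k * cos (α a y k - θ))
    (fun a y θ => hasDerivAt_u1Layer (c a y) (α a y) θ) (fun a y => continuous_u1LayerJac (c a y) (α a y))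
    (fun a y θ => u1LayerJac_pos (c a y) (α a y) (hκ a y) θ)
    (fun a y θ => u1Layer_add_two_pi (c a y) (α a y) θ)
    (fun a => measurable_fst.add (Finset.measurable_sum _ fun k _ =>
      ((hc a k).comp measurable_snd).mul
        (measurable_sin.comp (((hα a k).comp measurable_snd).sub measurable_fst))))
    (fun a => measurable_const.sub (Finset.measurable_sum _ fun k _ =>
      ((hc a k).comp measurable_snd).mul
        (measurable_cos.comp (((hα a k).comp measurable_snd).sub measurable_fst))))
    hψ hjac

end Coupling

end Summit.Ventures.LatticeQCDFlow.Exactness
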